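import Literature.NumberTheory.DiophantineGeometry.AbcShapeCount
import Literature.NumberTheory.DiophantineGeometry.AbcShapeFactorisation
import HarnessLib

/-!
# Reduction of `N_λ(X)` to the shape counts `B_d` (Bernert–Browning–Lichtman–Teräväinen, §2): the classes

[BernertEtAl2024, §2, Prop. 2.1] reduces the count `N_λ(X)` of abc triples of exponent `λ`
(`abcExponentCount`) to the shape counts `B_d(c; X, Y, Z)` (`AbcShapes.shapeCount`): each of
`a, b, c` is factorised by Lemma 2.2 (`bernertEtAl2024_lemma_2_2`) as `cᵢ ∏ⱼ xⱼʲ`, and after a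
dyadic decomposition of all the `xⱼ, yⱼ, zⱼ` a triple becomes a solution counted by some
`B_M(c; X, Y, Z)` with `M = ⌊10/ε²⌋`. This file sets up that bookkeeping:

* `AbcShapes.fac ε n` — a factorisation of `n ≥ 1` chosen by Lemma 2.2 (with its `X := n`),
  `AbcShapes.fac_spec`;
* `AbcShapes.tripleShapes ε t`, `AbcShapes.tripleClass ε t` — the shape tuples of a triple
  `t = (a, b, c)` and its *class* (the dyadic scale `k = ⌊log₂ c⌋`, the cofactors `c₁, c₂, c₃`,
  and the dyadic exponents of all shape variables);
* `AbcShapes.tripleShapes_mem_shapeTriples` — the shapes of an abc triple are counted by the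
  `B_M` of its class; `AbcShapes.eq_of_tripleClass_eq` — within a class, a triple is determined
  by its shapes;
* `AbcShapes.Admissible` and `AbcShapes.admissible_of_triple` — the size constraints satisfied
  by the data of a class containing an abc triple of exponent `λ`: `cᵢ ≤ (2C₀)^{ε/2}`,
  `∏ⱼ XⱼYⱼZⱼ ≤ (2C₀)^{λ+3ε}`, `cᵢ · (shape value) ≤ 2C₀`, `C₀ ≤ 2^{M(M+1)/2} c₃ ∏ Zⱼ^j`
  (`C₀ = 2^k`), i.e. (2.1)–(2.2) of the source in dyadic form.

The counting conclusion (`N_λ(X) ≤ #classes · max B_M`) is in `AbcShapeReductionCount`.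
Theorems 1.2/1.3 of the source (named facts of `AbcExceptionalSetBounds`) are NOT proved here.

## References

* [BernertEtAl2024] C. Bernert, T. Browning, J. D. Lichtman, J. Teräväinen, *Bounds on the
  exceptional set in the abc conjecture*, arXiv:2410.12234, §2: (2.1)–(2.4), Lemma 2.2,
  Proposition 2.1 (v1 and v2).
* [Bernert2025] C. Bernert, *The exceptional set in the abc conjecture*, arXiv:2506.13364, §2.
-/

noncomputable section

open Finset UniqueFactorizationMonoid

namespace Literature.NumberTheory.DiophantineGeometry

namespace AbcShapes

/-! ### Chosen shape factorisations -/

/-- The number `M = ⌊10/ε²⌋` of shape factors of Lemma 2.2. [cite: BernertEtAl2024, Lemma 2.2] -/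
def numShapes (ε : ℝ) : ℕ :=
  ⌊10 / ε ^ 2⌋₊

/-- The properties of a shape factorisation `n = c ∏_{j ≤ M} x_j^j` delivered by Lemma 2.2 (with
its parameter `X` taken to be `n`): positivity, the factorisation, `c ≤ n^{ε/2}` and
`n^{-ε} ∏ x_j ≤ rad n`. [cite: BernertEtAl2024, Lemma 2.2] -/
def IsShapeFac (ε : ℝ) (n : ℕ) (f : ℕ × (ℕ → ℕ)) : Prop :=
  0 < f.1 ∧ (∀ j, 0 < f.2 j) ∧ f.1 * ∏ j ∈ Icc 1 (numShapes ε), f.2 j ^ j = n ∧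
    (f.1 : ℝ) ≤ (n : ℝ) ^ (ε / 2) ∧
    (n : ℝ) ^ (-ε) * ∏ j ∈ Icc 1 (numShapes ε), (f.2 j : ℝ) ≤ (radical n : ℕ)

/-- Lemma 2.2 provides a shape factorisation of every `n ≥ 1`. [cite: BernertEtAl2024, Lemma 2.2] -/
theorem exists_isShapeFac {ε : ℝ} (hε : 0 < ε) (hε2 : ε < 1 / 2) {n : ℕ} (hn : 0 < n) :
    ∃ f : ℕ × (ℕ → ℕ), IsShapeFac ε n f := by
  obtain ⟨c, x, hc, hx, hfac, hcle, -, hrad, -⟩ := bernertEtAl2024_lemma_2_2 hε hε2 hn le_rfl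
  exact ⟨(c, x), hc, hx, hfac, hcle, hrad⟩

/-- A chosen shape factorisation of `n` (junk `(1, 1)` outside `0 < ε < 1/2`, `n ≥ 1`).
[cite: BernertEtAl2024, Lemma 2.2] -/
def fac (ε : ℝ) (n : ℕ) : ℕ × (ℕ → ℕ) :=
  if h : (0 < ε ∧ ε < 1 / 2) ∧ 0 < n then Classical.choose (exists_isShapeFac h.1.1 h.1.2 h.2)
  else (1, fun _ => 1)

/-- The chosen factorisation has the properties of Lemma 2.2. [cite: BernertEtAl2024, Lemma 2.2] -/
theorem fac_spec {ε : ℝ} (hε : 0 < ε) (hε2 : ε < 1 / 2) {n : ℕ} (hn : 0 < n) :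
    IsShapeFac ε n (fac ε n) := by
  rw [fac, dif_pos ⟨⟨hε, hε2⟩, hn⟩]
  exact Classical.choose_spec (exists_isShapeFac hε hε2 hn)

/-! ### Reindexing `{1, …, M}` by `Fin M`, and algebra of shape values -/

/-- View `x : ℕ → ℕ` on `{1, …, M}` as a tuple `Fin M → ℕ` (coordinate `i` is `x (i+1)`).
[folklore] -/
def toFin (M : ℕ) (x : ℕ → ℕ) : Fin M → ℕ := fun i => x ((i : ℕ) + 1)

/-- `∏_{i : Fin M} g (i+1) = ∏_{j ∈ [1, M]} g j`. [folklore] -/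
theorem prod_fin_succ_eq_prod_Icc (M : ℕ) (g : ℕ → ℕ) :
    ∏ i : Fin M, g ((i : ℕ) + 1) = ∏ j ∈ Icc 1 M, g j := by
  rw [Fin.prod_univ_eq_prod_range (fun i => g (i + 1)) M, range_eq_Ico, prod_Ico_add' g 0 M 1,
    zero_add, Finset.Ico_add_one_right_eq_Icc]

/-- The shape value of the reindexed tuple is `∏_{j ≤ M} x_j^j`. [folklore] -/
theorem shapeVal_toFin (M : ℕ) (x : ℕ → ℕ) :
    shapeVal (toFin M x) = ∏ j ∈ Icc 1 M, x j ^ j :=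
  prod_fin_succ_eq_prod_Icc M (fun j => x j ^ j)

/-- The plain product of the reindexed tuple is `∏_{j ≤ M} x_j`. [folklore] -/
theorem shapeProd_toFin (M : ℕ) (x : ℕ → ℕ) : shapeProd (toFin M x) = ∏ j ∈ Icc 1 M, x j :=
  prod_fin_succ_eq_prod_Icc M x

/-- Shape values are multiplicative in the tuple. [folklore] -/
theorem shapeVal_mul {d : ℕ} (u v : Fin d → ℕ) :
    shapeVal (fun i => u i * v i) = shapeVal u * shapeVal v := by
  simp only [shapeVal, mul_pow, prod_mul_distrib]

/-- Shape values are monotone in the tuple. [folklore] -/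
theorem shapeVal_mono {d : ℕ} {u v : Fin d → ℕ} (h : ∀ i, u i ≤ v i) : shapeVal u ≤ shapeVal v :=
  prod_le_prod (fun _ _ => Nat.zero_le _) fun i _ => Nat.pow_le_pow_left (h i) _

/-- Shape values of positive tuples are positive. [folklore] -/
theorem shapeVal_pos {d : ℕ} {u : Fin d → ℕ} (h : ∀ i, 0 < u i) : 0 < shapeVal u :=
  prod_pos fun i _ => pow_pos (h i) _

/-- Each coordinate of a positive tuple is at most its shape value. [folklore] -/
theorem le_shapeVal {d : ℕ} {u : Fin d → ℕ} (h : ∀ i, 0 < u i) (i : Fin d) : u i ≤ shapeVal u :=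
  (Nat.le_self_pow (Nat.succ_ne_zero _) (u i)).trans
    (Nat.le_of_dvd (shapeVal_pos h) (dvd_prod_of_mem (fun i => u i ^ ((i : ℕ) + 1)) (mem_univ i)))

/-- A prime dividing `c ∏ xᵢ` divides `c ∏ xᵢ^{i+1}`. [folklore] -/
theorem prime_dvd_mul_shapeVal {d p c : ℕ} (hp : p.Prime) {x : Fin d → ℕ}
    (h : p ∣ c * shapeProd x) : p ∣ c * shapeVal x := by
  rcases (Nat.Prime.dvd_mul hp).mp h with h1 | h1
  · exact dvd_mul_of_dvd_left h1 _
  · rw [shapeProd] at h1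
    obtain ⟨i, -, hi⟩ := (Prime.dvd_finsetProd_iff hp.prime _).mp h1
    exact dvd_mul_of_dvd_right ((dvd_pow hi (Nat.succ_ne_zero _)).trans
      (dvd_prod_of_mem (fun i => x i ^ ((i : ℕ) + 1)) (mem_univ i))) _

/-! ### Shapes and classes of triples -/

/-- The box parameters `Xᵢ = 2^{eᵢ}` of a vector of dyadic exponents. [folklore] -/
def classBox {M : ℕ} (e : Fin M → ℕ) : Fin M → ℕ := fun i => 2 ^ e i

/-- `2^{⌊log₂ u⌋} ≤ u < 2 · 2^{⌊log₂ u⌋}` for `u ≥ 1`: membership in the dyadic range. [folklore] -/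
theorem mem_Ico_pow_log {u : ℕ} (hu : 0 < u) :
    u ∈ Ico (2 ^ Nat.log 2 u) (2 * 2 ^ Nat.log 2 u) := by
  rw [mem_Ico, ← pow_succ']
  exact ⟨Nat.pow_log_le_self 2 hu.ne', Nat.lt_pow_succ_log_self one_lt_two u⟩

/-- The three shape tuples `(x, y, z)` of a triple `t = (a, b, c)` (from the chosen factorisations
of `a`, `b`, `c`). [cite: BernertEtAl2024, Proposition 2.1] -/
def tripleShapes (ε : ℝ) (t : ℕ × ℕ × ℕ) :
    (Fin (numShapes ε) → ℕ) × (Fin (numShapes ε) → ℕ) × (Fin (numShapes ε) → ℕ) :=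
  (toFin _ (fac ε t.1).2, toFin _ (fac ε t.2.1).2, toFin _ (fac ε t.2.2).2)

/-- The *class* of a triple `t = (a, b, c)`: the dyadic scale `⌊log₂ c⌋`, the cofactors
`(c₁, c₂, c₃)` of the factorisations of `a, b, c`, and the dyadic exponents `⌊log₂ ·⌋` of all
shape variables. [cite: BernertEtAl2024, Proposition 2.1] -/
def tripleClass (ε : ℝ) (t : ℕ × ℕ × ℕ) :
    ℕ × (ℕ × ℕ × ℕ) ×
      ((Fin (numShapes ε) → ℕ) × (Fin (numShapes ε) → ℕ) × (Fin (numShapes ε) → ℕ)) :=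
  (Nat.log 2 t.2.2, ((fac ε t.1).1, (fac ε t.2.1).1, (fac ε t.2.2).1),
    (fun i => Nat.log 2 ((tripleShapes ε t).1 i), fun i => Nat.log 2 ((tripleShapes ε t).2.1 i),
      fun i => Nat.log 2 ((tripleShapes ε t).2.2 i)))

section triple

variable {ε : ℝ} (hε : 0 < ε) (hε2 : ε < 1 / 2)
include hε hε2

/-- Unpacking the factorisation of `a` in terms of the shape tuple: positivity,
`a = c₁ · shapeVal x`, `c₁ ≤ a^{ε/2}`, `∏ xᵢ ≤ a^ε rad a`. [cite: BernertEtAl2024, Lemma 2.2] -/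
theorem fac_toFin_spec {n : ℕ} (hn : 0 < n) :
    0 < (fac ε n).1 ∧ (∀ i, 0 < toFin (numShapes ε) (fac ε n).2 i) ∧
      (fac ε n).1 * shapeVal (toFin (numShapes ε) (fac ε n).2) = n ∧
      ((fac ε n).1 : ℝ) ≤ (n : ℝ) ^ (ε / 2) ∧
      (shapeProd (toFin (numShapes ε) (fac ε n).2) : ℝ) ≤ (n : ℝ) ^ ε * (radical n : ℕ) := by
  obtain ⟨h1, h2, h3, h4, h5⟩ := fac_spec hε hε2 hn
  refine ⟨h1, fun i => h2 _, by rw [shapeVal_toFin]; exact h3, h4, ?_⟩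
  rw [shapeProd_toFin]
  push_cast
  have hn' : (0 : ℝ) < n := by exact_mod_cast hn
  have h6 : (n : ℝ) ^ ε * ((n : ℝ) ^ (-ε) * ∏ j ∈ Icc 1 (numShapes ε), ((fac ε n).2 j : ℝ)) ≤
      (n : ℝ) ^ ε * (radical n : ℕ) := mul_le_mul_of_nonneg_left h5 (by positivity)
  rwa [← mul_assoc, ← Real.rpow_add hn', add_neg_cancel, Real.rpow_zero, one_mul] at h6

/-- **The shapes of an abc triple are counted by the `B_M` of its class**: if
`tripleClass ε t = (k, (c₁, c₂, c₃), (e_X, e_Y, e_Z))` then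
`tripleShapes ε t ∈ shapeTriples c₁ c₂ c₃ 2^{e_X} 2^{e_Y} 2^{e_Z}`.
[cite: BernertEtAl2024, Proposition 2.1] -/
theorem tripleShapes_mem_shapeTriples {t : ℕ × ℕ × ℕ} (ht : IsABCTriple t.1 t.2.1 t.2.2)
    {k c₁ c₂ c₃ : ℕ} {eX eY eZ : Fin (numShapes ε) → ℕ}
    (hq : tripleClass ε t = (k, (c₁, c₂, c₃), (eX, eY, eZ))) :
    tripleShapes ε t ∈ shapeTriples c₁ c₂ c₃ (classBox eX) (classBox eY) (classBox eZ) := by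
  obtain ⟨a, b, c⟩ := t
  obtain ⟨ha, hb, habc, hcop⟩ := ht
  simp only at ha hb habc hcop
  have hc : 0 < c := by omega
  simp only [tripleClass, Prod.mk.injEq] at hq
  obtain ⟨-, ⟨rfl, rfl, rfl⟩, rfl, rfl, rfl⟩ := hq
  obtain ⟨-, hxa, hfa, -, -⟩ := fac_toFin_spec hε hε2 ha
  obtain ⟨-, hxb, hfb, -, -⟩ := fac_toFin_spec hε hε2 hb
  obtain ⟨-, hxc, hfc, -, -⟩ := fac_toFin_spec hε hε2 hc
  simp only [tripleShapes] at hxa hxb hxc hfa hfb hfc ⊢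
  rw [shapeTriples, mem_filter, mem_product, mem_product]
  refine ⟨⟨?_, ?_, ?_⟩, ?_, ?_⟩
  · exact mem_dyadicBox.mpr fun i => mem_Ico.mp (mem_Ico_pow_log (hxa i))
  · exact mem_dyadicBox.mpr fun i => mem_Ico.mp (mem_Ico_pow_log (hxb i))
  · exact mem_dyadicBox.mpr fun i => mem_Ico.mp (mem_Ico_pow_log (hxc i))
  · rw [hfa, hfb, hfc]; exact habc
  · -- `gcd(c₁ ∏ x, c₂ ∏ y, c₃ ∏ z) = 1` from `gcd(a, b) = 1`
    have hcop' : Nat.Coprime ((fac ε a).1 * shapeProd (toFin (numShapes ε) (fac ε a).2))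
        ((fac ε b).1 * shapeProd (toFin (numShapes ε) (fac ε b).2)) := by
      refine Nat.coprime_of_dvd fun p hp h1 h2 => ?_
      have h1' : p ∣ a := by rw [← hfa]; exact prime_dvd_mul_shapeVal hp h1
      have h2' : p ∣ b := by rw [← hfb]; exact prime_dvd_mul_shapeVal hp h2
      exact hp.one_lt.ne' (Nat.dvd_one.mp (hcop ▸ Nat.dvd_gcd h1' h2'))
    exact Nat.Coprime.coprime_dvd_right (Nat.gcd_dvd_left _ _) hcop'

/-- **Within a class, a triple is determined by its shapes.** [cite: BernertEtAl2024, Proposition 2.1] -/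
theorem eq_of_tripleClass_eq {t t' : ℕ × ℕ × ℕ} (ht : IsABCTriple t.1 t.2.1 t.2.2)
    (ht' : IsABCTriple t'.1 t'.2.1 t'.2.2) (hcl : tripleClass ε t = tripleClass ε t')
    (hsh : tripleShapes ε t = tripleShapes ε t') : t = t' := by
  obtain ⟨a, b, c⟩ := t
  obtain ⟨a', b', c'⟩ := t'
  obtain ⟨ha, hb, habc, -⟩ := ht
  obtain ⟨ha', hb', habc', -⟩ := ht'
  simp only at ha hb habc ha' hb' habc'
  simp only [tripleClass, Prod.mk.injEq] at hcl
  obtain ⟨-, ⟨h1, h2, h3⟩, -⟩ := hcl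
  simp only [tripleShapes, Prod.mk.injEq] at hsh
  obtain ⟨hs1, hs2, hs3⟩ := hsh
  have hfa := (fac_toFin_spec hε hε2 ha).2.2.1
  have hfb := (fac_toFin_spec hε hε2 hb).2.2.1
  have hfa' := (fac_toFin_spec hε hε2 ha').2.2.1
  have hfb' := (fac_toFin_spec hε hε2 hb').2.2.1
  have hA : a = a' := by rw [← hfa, ← hfa', h1, hs1]
  have hB : b = b' := by rw [← hfb, ← hfb', h2, hs2]
  simp only [Prod.mk.injEq]
  exact ⟨hA, hB, by omega⟩

end triple

/-! ### Admissible data -/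

/-- The size constraints on the data `(C₀; c₁, c₂, c₃; X, Y, Z)` of a class of abc triples of
exponent `l` at dyadic scale `C₀` (see `admissible_of_triple`): the dyadic form of (2.1)–(2.2) of
[BernertEtAl2024] together with `cᵢ ≤ (2C₀)^{ε/2}`. [cite: BernertEtAl2024, Proposition 2.1] -/
structure Admissible (l ε : ℝ) {M : ℕ} (C₀ c₁ c₂ c₃ : ℕ) (X Y Z : Fin M → ℕ) : Prop where
  one_le : 1 ≤ C₀
  pos₁ : 0 < c₁
  pos₂ : 0 < c₂
  pos₃ : 0 < c₃
  le₁ : (c₁ : ℝ) ≤ (2 * C₀ : ℝ) ^ (ε / 2)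
  le₂ : (c₂ : ℝ) ≤ (2 * C₀ : ℝ) ^ (ε / 2)
  le₃ : (c₃ : ℝ) ≤ (2 * C₀ : ℝ) ^ (ε / 2)
  X_pos : ∀ i, 0 < X i
  Y_pos : ∀ i, 0 < Y i
  Z_pos : ∀ i, 0 < Z i
  prod_le : (∏ i, ((X i : ℝ) * Y i * Z i)) ≤ (2 * C₀ : ℝ) ^ (l + 3 * ε)
  valX_le : c₁ * shapeVal X ≤ 2 * C₀
  valY_le : c₂ * shapeVal Y ≤ 2 * C₀
  valZ_le : c₃ * shapeVal Z ≤ 2 * C₀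
  le_valZ : C₀ ≤ shapeVal (fun _ : Fin M => 2) * (c₃ * shapeVal Z)

/-- `rad(abc) = rad a · rad b · rad c` for an abc triple (pairwise coprimality). [folklore] -/
theorem rad_eq_mul_of_isABCTriple {a b c : ℕ} (ht : IsABCTriple a b c) :
    rad a b c = radical a * radical b * radical c := by
  obtain ⟨-, -, habc, hcop⟩ := ht
  have hac : Nat.Coprime a c := by rw [← habc]; exact Nat.coprime_self_add_right.mpr hcop
  have hbc : Nat.Coprime b c := by rw [← habc]; exact Nat.coprime_add_self_right.mpr hcop.symm
  rw [rad_def, radical_mul (Nat.coprime_iff_isRelPrime.mp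
    (Nat.coprime_mul_iff_left.mpr ⟨hac, hbc⟩)), radical_mul (Nat.coprime_iff_isRelPrime.mp hcop)]

/-- **The class of an abc triple of exponent `l ≥ 0` is admissible** at its dyadic scale
`C₀ = 2^k ≤ c`. [cite: BernertEtAl2024, Proposition 2.1] -/
theorem admissible_of_triple {ε : ℝ} (hε : 0 < ε) (hε2 : ε < 1 / 2) {l : ℝ} (hl : 0 ≤ l)
    {t : ℕ × ℕ × ℕ} (ht : IsABCTriple t.1 t.2.1 t.2.2)
    (hrad : ((rad t.1 t.2.1 t.2.2 : ℕ) : ℝ) < (t.2.2 : ℝ) ^ l)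
    {k c₁ c₂ c₃ : ℕ} {eX eY eZ : Fin (numShapes ε) → ℕ}
    (hq : tripleClass ε t = (k, (c₁, c₂, c₃), (eX, eY, eZ))) :
    Admissible l ε (2 ^ k) c₁ c₂ c₃ (classBox eX) (classBox eY) (classBox eZ) ∧ 2 ^ k ≤ t.2.2 := by
  obtain ⟨a, b, c⟩ := t
  have ht' := ht
  obtain ⟨ha, hb, habc, hcop⟩ := ht
  simp only at ha hb habc hcop hrad ⊢
  have hc : 0 < c := by omega
  simp only [tripleClass, Prod.mk.injEq] at hq
  obtain ⟨rfl, ⟨rfl, rfl, rfl⟩, rfl, rfl, rfl⟩ := hq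
  obtain ⟨hca, hxa, hfa, hcale, hpa⟩ := fac_toFin_spec hε hε2 ha
  obtain ⟨hcb, hxb, hfb, hcble, hpb⟩ := fac_toFin_spec hε hε2 hb
  obtain ⟨hcc, hxc, hfc, hccle, hpc⟩ := fac_toFin_spec hε hε2 hc
  simp only [tripleShapes] at *
  -- notation
  set M := numShapes ε with hM
  set xa := toFin M (fac ε a).2 with hxa'
  set xb := toFin M (fac ε b).2 with hxb'
  set xc := toFin M (fac ε c).2 with hxc'
  set C₀ : ℕ := 2 ^ Nat.log 2 c with hC₀
  -- the dyadic scale: `C₀ ≤ c < 2 C₀`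
  have hC₀c : C₀ ≤ c ∧ c < 2 * C₀ := mem_Ico.mp (mem_Ico_pow_log hc)
  have hC₀1 : 1 ≤ C₀ := Nat.one_le_two_pow
  have h2C₀ : (0 : ℝ) ≤ 2 * C₀ := by positivity
  have hc2 : (c : ℝ) ≤ 2 * C₀ := by exact_mod_cast hC₀c.2.le
  have ha2 : (a : ℝ) ≤ 2 * C₀ := le_trans (by exact_mod_cast (by omega : a ≤ c)) hc2
  have hb2 : (b : ℝ) ≤ 2 * C₀ := le_trans (by exact_mod_cast (by omega : b ≤ c)) hc2
  -- boxes: `2^{e i} ≤ x i`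
  have hbx : ∀ i, classBox (fun i => Nat.log 2 (xa i)) i ≤ xa i := fun i =>
    (mem_Ico.mp (mem_Ico_pow_log (hxa i))).1
  have hby : ∀ i, classBox (fun i => Nat.log 2 (xb i)) i ≤ xb i := fun i =>
    (mem_Ico.mp (mem_Ico_pow_log (hxb i))).1
  have hbz : ∀ i, classBox (fun i => Nat.log 2 (xc i)) i ≤ xc i := fun i =>
    (mem_Ico.mp (mem_Ico_pow_log (hxc i))).1
  have hbz' : ∀ i, xc i ≤ 2 * classBox (fun i => Nat.log 2 (xc i)) i := fun i =>
    (mem_Ico.mp (mem_Ico_pow_log (hxc i))).2.le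
  refine ⟨⟨hC₀1, hca, hcb, hcc, ?_, ?_, ?_, fun i => Nat.two_pow_pos _, fun i => Nat.two_pow_pos _,
    fun i => Nat.two_pow_pos _, ?_, ?_, ?_, ?_, ?_⟩, hC₀c.1⟩
  · exact hcale.trans (Real.rpow_le_rpow (by positivity) ha2 (by positivity))
  · exact hcble.trans (Real.rpow_le_rpow (by positivity) hb2 (by positivity))
  · exact hccle.trans (Real.rpow_le_rpow (by positivity) hc2 (by positivity))
  · -- `∏ XᵢYᵢZᵢ ≤ ∏ xa · ∏ xb · ∏ xc ≤ (abc)^ε-ish · rad(abc) < (2C₀)^{3ε} c^l ≤ (2C₀)^{l+3ε}`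
    have h1 : (∏ i, ((classBox (fun i => Nat.log 2 (xa i)) i : ℝ) *
        (classBox (fun i => Nat.log 2 (xb i)) i) * (classBox (fun i => Nat.log 2 (xc i)) i))) ≤
        (shapeProd xa : ℝ) * shapeProd xb * shapeProd xc := by
      rw [shapeProd, shapeProd, shapeProd]
      push_cast
      rw [← prod_mul_distrib, ← prod_mul_distrib]
      refine prod_le_prod (fun i _ => by positivity) fun i _ => ?_
      have := hbx i; have := hby i; have := hbz i
      gcongr
    have hεpow : ∀ {n : ℕ}, (n : ℝ) ≤ 2 * C₀ → (n : ℝ) ^ ε ≤ (2 * C₀ : ℝ) ^ ε := fun hn =>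
      Real.rpow_le_rpow (by positivity) hn hε.le
    have hradabc : ((radical a : ℕ) : ℝ) * (radical b : ℕ) * (radical c : ℕ) < (2 * C₀ : ℝ) ^ l := by
      have h2 : ((rad a b c : ℕ) : ℝ) = ((radical a : ℕ) : ℝ) * (radical b : ℕ) * (radical c : ℕ) := by
        rw [rad_eq_mul_of_isABCTriple ht']; push_cast; ring
      rw [← h2]
      exact hrad.trans_le (Real.rpow_le_rpow (by positivity) hc2 hl)
    have h3 : (shapeProd xa : ℝ) * shapeProd xb * shapeProd xc ≤
        ((2 * C₀ : ℝ) ^ ε) ^ 3 * (((radical a : ℕ) : ℝ) * (radical b : ℕ) * (radical c : ℕ)) := by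
      calc (shapeProd xa : ℝ) * shapeProd xb * shapeProd xc
          ≤ ((a : ℝ) ^ ε * (radical a : ℕ)) * ((b : ℝ) ^ ε * (radical b : ℕ)) *
              ((c : ℝ) ^ ε * (radical c : ℕ)) := by
            gcongr
        _ ≤ ((2 * C₀ : ℝ) ^ ε * (radical a : ℕ)) * ((2 * C₀ : ℝ) ^ ε * (radical b : ℕ)) *
              ((2 * C₀ : ℝ) ^ ε * (radical c : ℕ)) := by
            gcongr
        _ = ((2 * C₀ : ℝ) ^ ε) ^ 3 * (((radical a : ℕ) : ℝ) * (radical b : ℕ) * (radical c : ℕ)) := by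
            ring
    have h4 : ((2 * C₀ : ℝ) ^ ε) ^ 3 * (2 * C₀ : ℝ) ^ l = (2 * C₀ : ℝ) ^ (l + 3 * ε) := by
      have h0 : (0 : ℝ) < 2 * C₀ := by positivity
      rw [← Real.rpow_natCast, ← Real.rpow_mul h0.le, ← Real.rpow_add h0]
      congr 1; push_cast; ring
    calc _ ≤ (shapeProd xa : ℝ) * shapeProd xb * shapeProd xc := h1
      _ ≤ ((2 * C₀ : ℝ) ^ ε) ^ 3 * (((radical a : ℕ) : ℝ) * (radical b : ℕ) * (radical c : ℕ)) := h3
      _ ≤ ((2 * C₀ : ℝ) ^ ε) ^ 3 * (2 * C₀ : ℝ) ^ l :=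
          mul_le_mul_of_nonneg_left hradabc.le (by positivity)
      _ = (2 * C₀ : ℝ) ^ (l + 3 * ε) := h4
  · -- `c₁ · shapeVal X ≤ a ≤ 2 C₀`
    calc (fac ε a).1 * shapeVal (classBox fun i => Nat.log 2 (xa i))
        ≤ (fac ε a).1 * shapeVal xa := Nat.mul_le_mul_left _ (shapeVal_mono hbx)
      _ = a := hfa
      _ ≤ 2 * C₀ := by omega
  · calc (fac ε b).1 * shapeVal (classBox fun i => Nat.log 2 (xb i))
        ≤ (fac ε b).1 * shapeVal xb := Nat.mul_le_mul_left _ (shapeVal_mono hby)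
      _ = b := hfb
      _ ≤ 2 * C₀ := by omega
  · calc (fac ε c).1 * shapeVal (classBox fun i => Nat.log 2 (xc i))
        ≤ (fac ε c).1 * shapeVal xc := Nat.mul_le_mul_left _ (shapeVal_mono hbz)
      _ = c := hfc
      _ ≤ 2 * C₀ := hC₀c.2.le
  · -- `C₀ ≤ c = c₃ shapeVal xc ≤ c₃ · shapeVal (2 Z) = shapeVal 2 · (c₃ shapeVal Z)`
    calc C₀ ≤ c := hC₀c.1
      _ = (fac ε c).1 * shapeVal xc := hfc.symm
      _ ≤ (fac ε c).1 * shapeVal (fun i => 2 * classBox (fun i => Nat.log 2 (xc i)) i) :=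
          Nat.mul_le_mul_left _ (shapeVal_mono hbz')
      _ = shapeVal (fun _ : Fin M => 2) *
            ((fac ε c).1 * shapeVal (classBox fun i => Nat.log 2 (xc i))) := by
          rw [shapeVal_mul]; ring

end AbcShapes

end Literature.NumberTheory.DiophantineGeometry
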